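/-
Copyright: the b2b-balaban T⁴-continuum CRUX team, row NE7b, leaf lineage `t4-ne7b-formalise-leaf-02` (gen 131). Project licence.
-/
import Summits.QuantumFields.BalabanUV.T4Continuum.Spine.NE7b.PlaquetteCubicConstants
import Summits.QuantumFields.BalabanUV.T4Continuum.Spine.NE7b.PlaquetteCubicBlockTable
import Summits.QuantumFields.BalabanUV.T4Continuum.Spine.NE7b.ConvexWindowSuppliersCells

/-!
# THE LATTICE SUM OF PLAQUETTE CUBICS: in a bond-block chart of a WHOLE lattice every plaquette term `g_p·P₃(x ∘ ι_p)` has the block table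
# `≤ 6|g_p|` at the four bonds it reads and NO block entry elsewhere, so the windowed road's block-Schur END holds for
# `⟪x, A x⟫ + Σ_p g_p·P₃(x ∘ ι_p)` on T-61's per-bond window with modulus `2σ − 6·ν·γ·a` — `ν` = plaquettes per bond, `|g_p| ≤ γ`
# (row NE7b, node U5c; letter (ℓ1): the lattice bookkeeping that `…PlaquetteCubicBlockTable` ∕ `…ConvexWindowSuppliersCells` leave to a sequel —
# the desk's «per-plaquette constant × plaquettes per bond», ρ-ne7bref-g75-1 `36 = 6 × 6`, AS A THEOREM with `ν` displayed)

Cell `pub-balaban`, sub-cell `t4`, spine estimate NE7b (`T4WeightBudget.RelWeightBound`; the cell's OWN estimate — NOT PRINTED in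
[Bałaban 1983–89], NOT PROVED).  Crux-route work under `Spine/NE7b/` by the row's E-side ∕ key-readings ∕ lattice-geometry leaf lineage; NOTHING
of Bałaban's is named or asserted; no `T4Continuum/Support` leaf typed; no `def`, no notation; zero `sorry`.  Imports (all in the tree):
`…PlaquetteCubicConstants` (Hadamard), `…PlaquetteCubicBlockTable` (the one-plaquette count), `…ConvexWindowSuppliersCells` (→ `…Local`).

SETTING.  Bonds `b : B` of an ARBITRARY finite bond set, a chart `e : Fin n ≃ B × Fin 3` (three colour coordinates per bond, `x_b ∈ ℝ³ ≅ su(2)`),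
block reader `β v b i = v (e.symm (b, i))` (`hβ`) and block projections `(Q b x) j = x j` on block `b`, `0` off it (`hQ`) — `…PlaquetteCubicBlockTable`'s
hypotheses over `B`, inhabited in §4; plaquettes `p : 𝔓` each reading four DISTINCT bonds `ι_p : Fin 4 → B`;
the lattice cubic `Σ_p g_p·P₃(x_{ι_p 0}, …, x_{ι_p 3})`, `P₃(x₀,…,x₃) = det(x₀,x₁,x₂) + det(x₀,x₁,x₃) − det(x₀,x₂,x₃) − det(x₁,x₂,x₃)` (`det` the triple
product; its identification with the Wilson action's cubic Taylor term at the flat background is idea-1's T-71 ∕ the desk's F463 (i) — READ, not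
re-derived; `g_p` carries couplings and orientation signs).  Displayed by the END: `σ` (quadratic bottom), `γ ≥ |g_p|`, the per-bond radius `a`,
and the LATTICE-GEOMETRIC overlap `ν` (every bond in at most `ν` plaquettes; `2(d−1) = 6` on the periodic lattice at `d = 4` —
`…TorusPlaquetteIncidence` — whence the desk's `36|g|`): modulus `2σ − 6·ν·γ·a`, volume-independent.

WHAT IS PROVED ([folklore] multilinear algebra, `E = EuclideanSpace ℝ (Fin n)`):
* §1 blocks over `B`: `block_proj`, `block_dotProduct_self_le`, `abs_det3_blocks_le` (Hadamard in blocks — Hadamard itself BY NAME from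
  `…PlaquetteCubicConstants.triple_product_sq_le`: the junction of the lineage's two cubic files), `proj_sum` ∕ `proj_idem` ∕ `proj_pythagoras`.
* §2 one plaquette IN the lattice (`ι : Fin 4 → B` injective; `f` any continuous trilinear form with `f m = g·𝔭_ι(m)`, `𝔭_ι` the slot form of
  `P₃(x ∘ ι)`): `det3_proj`, **`norm_blockEntry_le`** (`‖D³P(z) ∘ (Q_{r0},Q_{r1},Q_{r2})‖_op ≤ |g|·N_ι(r)`, `N_ι(r)` = the number of pairs (`σ ∈ S₃`,
  signed term) matched by `r ∘ σ` against `ι`), `eq_comp_of_match` ∕ **`matchCount_eq_zero_of_forall_ne`** (a matched triple factors through `ι`),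
  **`sum_matchCount_eq_six`** (`Σ_{r : r s = ι j} N_ι(r) = 6`: reindex along `r' ↦ ι ∘ r'` onto `…PlaquetteCubicBlockTable.count_matches_eq_six`), the
  table **`blockFibreSum_thirdDeriv_le`** (`≤ 6|g|` at the plaquette's bonds) and the locality **`blockEntry_eq_zero`** (`= 0` off them).
* §3 `iteratedFDeriv_two_sum_diag_zero` (`D²(Σ_p f_p(x,x,x))(0) = 0`); §4 the hypotheses INHABITED over `B`: `exists_proj`, `exists_slotForm`.
* §5 the ENDs: **`firstOrderOn_quadratic_add_latticeSlotForms_blockWindow`** = `…ConvexWindowSuppliersCells.firstOrderOn_quadratic_add_sum_of_cellTables_blockWindow`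
  with EVERY structural hypothesis discharged (`S_p = range ι_p`, `c = 6γ`, `‖D²P(0)‖ = 0`): on `K = L ∩ ⋂_b {‖Q_b y‖ ≤ a}`, `A` symmetric
  `σ`-coercive, `|g_p| ≤ γ`, every bond in at most `ν` plaquettes ⟹ `∀ x y ∈ K, V x + ⟪∇V x, y − x⟫ + (2σ − 6νγa)∕2·‖y − x‖² ≤ V y` for
  `V = ⟪·, A ·⟫ + Σ_p f_p(·,·,·)`; and the `f`-free, reader-free **`firstOrderOn_quadratic_add_latticeCubic`** (`V = ⟪·, A ·⟫ + Σ_p g_p·P₃(x ∘ ι_p)`).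

NOT HERE (honest): the quartic and higher Taylor terms and non-flat backgrounds (their own per-cell tables add to `c`); WHICH `σ`, `g_p`, `a`, `L` are
Bałaban's at step `k` and in which chart print's small-field window is a product of per-bond balls ((A3) ∕ (A1c); refuter v101 §3 (i)–(ii), F515;
NC-NE7b-α UNRULED); anything of Bałaban's.  BY-NAME EFFECT ON THE WALL: NONE (a by-value supplier for ONE displayed letter of the leading anharmonic
term at the flat background, now volume-independent).  NE7b NOT PRINTED ∕ NOT PROVED; spine PROVED 0∕9; rung (B)+1 on a FINITE torus — NOT infinite
volume, NOT the mass gap, NOT Clay.  HONEST DEPENDENCY: continuum YM on T⁴ ⇐ BetaPertH ∧ nine spine estimates (0/9 proved); BetaPertH ⇐ (D1) ∧ (D4) ∧ CAP+tail.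
-/

set_option autoImplicit false

noncomputable section

open Real InnerProductSpace Set Finset Equiv
open scoped RealInnerProductSpace Matrix Gradient

namespace Summit.QuantumFields.BalabanUV.T4Continuum.NE7b.PlaquetteCubicLattice

variable {n : ℕ} {B : Type*}

/-! ## §1 Bond blocks over an arbitrary finite bond set `B` (chart `e : Fin n ≃ B × Fin 3`) -/

section Blocks

variable (e : Fin n ≃ B × Fin 3) (β : EuclideanSpace ℝ (Fin n) → B → Fin 3 → ℝ)
  (Q : B → EuclideanSpace ℝ (Fin n) →L[ℝ] EuclideanSpace ℝ (Fin n))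

/-- The `b`-block of `Q b' v` is the `b`-block of `v` if `b = b'`, else zero. [folklore] -/
theorem block_proj [DecidableEq B] (hβ : ∀ v b i, β v b i = v (e.symm (b, i))) (hQ : ∀ b x j, Q b x j = if (e j).1 = b then x j else 0)
    (b b' : B) (v : EuclideanSpace ℝ (Fin n)) : β (Q b' v) b = if b = b' then β v b else 0 := by
  funext i
  rw [hβ, hQ, Equiv.apply_symm_apply]
  split_ifs with h
  · rw [hβ]
  · rfl

/-- The squared length of the `b`-block of `v` is at most `‖v‖²`. [folklore] -/
theorem block_dotProduct_self_le (hβ : ∀ v b i, β v b i = v (e.symm (b, i))) (b : B) (v : EuclideanSpace ℝ (Fin n)) :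
    β v b ⬝ᵥ β v b ≤ ‖v‖ ^ 2 := by
  have hinj : Function.Injective (fun i : Fin 3 => e.symm (b, i)) := fun i j hij => by
    simpa using congrArg (fun k => (e k).2) hij
  calc _ = ∑ i : Fin 3, ‖v (e.symm (b, i))‖ ^ 2 := by simp only [dotProduct, hβ, Real.norm_eq_abs, sq, abs_mul_abs_self]
    _ = ∑ j ∈ Finset.univ.image (fun i : Fin 3 => e.symm (b, i)), ‖v j‖ ^ 2 := by
        rw [Finset.sum_image fun i _ j _ h => hinj h]
    _ ≤ ‖v‖ ^ 2 := by
        rw [EuclideanSpace.norm_sq_eq]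
        exact Finset.sum_le_sum_of_subset_of_nonneg (Finset.subset_univ _) fun j _ _ => sq_nonneg _

/-- **HADAMARD IN BLOCKS** over a bond set: `|det(u|_a, v|_b, w|_c)| ≤ ‖u‖·‖v‖·‖w‖` — Hadamard for three vectors of ℝ³ BY NAME (`…PlaquetteCubicConstants.triple_product_sq_le`, leaf-02 g129) and `|v|_b|² ≤ ‖v‖²`. [folklore] -/
theorem abs_det3_blocks_le (hβ : ∀ v b i, β v b i = v (e.symm (b, i))) (a b c : B) (u v w : EuclideanSpace ℝ (Fin n)) :
    |β u a ⬝ᵥ β v b ⨯₃ β w c| ≤ ‖u‖ * ‖v‖ * ‖w‖ := by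
  have hnn : ∀ p : Fin 3 → ℝ, 0 ≤ p ⬝ᵥ p := fun p => Finset.sum_nonneg fun i _ => mul_self_nonneg _
  have hb : ∀ (d : B) (x : EuclideanSpace ℝ (Fin n)), β x d ⬝ᵥ β x d ≤ ‖x‖ ^ 2 := fun d x => block_dotProduct_self_le e β hβ d x
  refine abs_le_of_sq_le_sq ?_ (by positivity)
  calc (β u a ⬝ᵥ β v b ⨯₃ β w c) ^ 2 ≤ (β u a ⬝ᵥ β u a) * (β v b ⬝ᵥ β v b) * (β w c ⬝ᵥ β w c) :=
        PlaquetteCubicConstants.triple_product_sq_le _ _ _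
    _ ≤ ‖u‖ ^ 2 * ‖v‖ ^ 2 * ‖w‖ ^ 2 :=
        mul_le_mul (mul_le_mul (hb a u) (hb b v) (hnn _) (sq_nonneg _)) (hb c w) (hnn _) (by positivity)
    _ = (‖u‖ * ‖v‖ * ‖w‖) ^ 2 := by ring

/-- The block projections sum to the identity. [folklore] -/
theorem proj_sum [Fintype B] [DecidableEq B] (hQ : ∀ b x j, Q b x j = if (e j).1 = b then x j else 0) (x : EuclideanSpace ℝ (Fin n)) :
    ∑ b, Q b x = x := by
  ext j
  simp [WithLp.ofLp_sum, hQ]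

/-- The block projections are idempotent. [folklore] -/
theorem proj_idem [DecidableEq B] (hQ : ∀ b x j, Q b x j = if (e j).1 = b then x j else 0) (b : B) (x : EuclideanSpace ℝ (Fin n)) :
    Q b (Q b x) = Q b x := by
  ext j
  rw [hQ, hQ]
  split_ifs <;> rfl

/-- Pythagoras over the blocks: `Σ_b ‖Q_b x‖² = ‖x‖²`. [folklore] -/
theorem proj_pythagoras [Fintype B] [DecidableEq B] (hQ : ∀ b x j, Q b x j = if (e j).1 = b then x j else 0) (x : EuclideanSpace ℝ (Fin n)) :
    ∑ b, ‖Q b x‖ ^ 2 = ‖x‖ ^ 2 := by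
  have hsq : ∀ b, ‖Q b x‖ ^ 2 = ∑ j ∈ univ.filter (fun j => (e j).1 = b), ‖x j‖ ^ 2 := fun b => by
    rw [EuclideanSpace.norm_sq_eq, Finset.sum_filter]
    refine Finset.sum_congr rfl fun j _ => ?_
    rw [hQ]; split_ifs <;> simp
  simp_rw [hsq]
  rw [EuclideanSpace.norm_sq_eq x, ← Finset.sum_fiberwise univ (fun j => (e j).1) (fun j => ‖x j‖ ^ 2)]

end Blocks

/-! ## §2 One plaquette IN the lattice: its four bonds `ι : Fin 4 → B`, the block entries of `D³(g·P₃(x ∘ ι))`, the table and the locality -/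

section Plaquette

variable (e : Fin n ≃ B × Fin 3) (β : EuclideanSpace ℝ (Fin n) → B → Fin 3 → ℝ)
  (Q : B → EuclideanSpace ℝ (Fin n) →L[ℝ] EuclideanSpace ℝ (Fin n)) (ι : Fin 4 → B)

/-- A signed-determinant term on block-projected arguments is the term if the blocks match and vanishes otherwise. [folklore] -/
theorem det3_proj [DecidableEq B] (hβ : ∀ v b i, β v b i = v (e.symm (b, i))) (hQ : ∀ b x j, Q b x j = if (e j).1 = b then x j else 0)
    (a b c b₀ b₁ b₂ : B) (v₀ v₁ v₂ : EuclideanSpace ℝ (Fin n)) :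
    β (Q b₀ v₀) a ⬝ᵥ β (Q b₁ v₁) b ⨯₃ β (Q b₂ v₂) c
      = if b₀ = a ∧ b₁ = b ∧ b₂ = c then β v₀ a ⬝ᵥ β v₁ b ⨯₃ β v₂ c else 0 := by
  rw [block_proj e β Q hβ hQ a b₀ v₀, block_proj e β Q hβ hQ b b₁ v₁, block_proj e β Q hβ hQ c b₂ v₂]
  by_cases h : b₀ = a ∧ b₁ = b ∧ b₂ = c
  · rw [if_pos h, if_pos h.1.symm, if_pos h.2.1.symm, if_pos h.2.2.symm]
  · rw [if_neg h]
    apply PlaquetteCubicBlockTable.det3_eq_zero_of_or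
    by_cases h0 : a = b₀
    · by_cases h1 : b = b₁
      · exact Or.inr (Or.inr (if_neg fun h2 => h ⟨h0.symm, h1.symm, h2.symm⟩))
      · exact Or.inr (Or.inl (if_neg h1))
    · exact Or.inl (if_neg h0)

/-- The same term, bounded by `[match]·‖v₀‖‖v₁‖‖v₂‖`. [folklore] -/
theorem abs_det3_proj_le [DecidableEq B] (hβ : ∀ v b i, β v b i = v (e.symm (b, i))) (hQ : ∀ b x j, Q b x j = if (e j).1 = b then x j else 0)
    (a b c b₀ b₁ b₂ : B) (v₀ v₁ v₂ : EuclideanSpace ℝ (Fin n)) :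
    |β (Q b₀ v₀) a ⬝ᵥ β (Q b₁ v₁) b ⨯₃ β (Q b₂ v₂) c|
      ≤ ((if b₀ = a ∧ b₁ = b ∧ b₂ = c then 1 else 0 : ℕ) : ℝ) * (‖v₀‖ * ‖v₁‖ * ‖v₂‖) := by
  rw [det3_proj e β Q hβ hQ]
  split_ifs
  · rw [Nat.cast_one, one_mul]; exact abs_det3_blocks_le e β hβ a b c v₀ v₁ v₂
  · simp

/-- **THE BLOCK ENTRIES OF `D³P` FOR A PLAQUETTE TERM IN THE LATTICE**: `P = (x ↦ f(x,x,x))`, `f m = g·𝔭_ι(m)`; for every block triple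
`r : Fin 3 → B` and every point `z`, `‖D³P(z) ∘ (Q_{r0}, Q_{r1}, Q_{r2})‖_op ≤ |g|·N_ι(r)`, `N_ι(r)` = the number of pairs (`σ ∈ S₃`, signed term
`(a,b,c)`) with `(r(σ0), r(σ1), r(σ2)) = (ι a, ι b, ι c)` (Mathlib's `ContinuousMultilinearMap.iteratedFDeriv_comp_diagonal`; Hadamard in blocks). [folklore] -/
theorem norm_blockEntry_le [DecidableEq B] (hβ : ∀ v b i, β v b i = v (e.symm (b, i))) (hQ : ∀ b x j, Q b x j = if (e j).1 = b then x j else 0)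
    (f : ContinuousMultilinearMap ℝ (fun _ : Fin 3 => EuclideanSpace ℝ (Fin n)) ℝ) (g : ℝ)
    (hf : ∀ m, f m = g * (β (m 0) (ι 0) ⬝ᵥ β (m 1) (ι 1) ⨯₃ β (m 2) (ι 2) + β (m 0) (ι 0) ⬝ᵥ β (m 1) (ι 1) ⨯₃ β (m 2) (ι 3)
      - β (m 0) (ι 0) ⬝ᵥ β (m 1) (ι 2) ⨯₃ β (m 2) (ι 3) - β (m 0) (ι 1) ⬝ᵥ β (m 1) (ι 2) ⨯₃ β (m 2) (ι 3)))
    (z : EuclideanSpace ℝ (Fin n)) (r : Fin 3 → B) :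
    ‖(iteratedFDeriv ℝ 3 (fun x => f (fun _ => x)) z).compContinuousLinearMap (fun s => Q (r s))‖ ≤ |g| *
      ((∑ σ : Equiv.Perm (Fin 3),
        ((if r (σ 0) = ι 0 ∧ r (σ 1) = ι 1 ∧ r (σ 2) = ι 2 then 1 else 0) + (if r (σ 0) = ι 0 ∧ r (σ 1) = ι 1 ∧ r (σ 2) = ι 3 then 1 else 0)
          + (if r (σ 0) = ι 0 ∧ r (σ 1) = ι 2 ∧ r (σ 2) = ι 3 then 1 else 0)
          + (if r (σ 0) = ι 1 ∧ r (σ 1) = ι 2 ∧ r (σ 2) = ι 3 then 1 else 0)) : ℕ) : ℝ) := by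
  refine ContinuousMultilinearMap.opNorm_le_bound (by positivity) fun m => ?_
  rw [ContinuousMultilinearMap.compContinuousLinearMap_apply, ContinuousMultilinearMap.iteratedFDeriv_comp_diagonal,
    Real.norm_eq_abs, Nat.cast_sum, Finset.mul_sum, Finset.sum_mul]
  refine (Finset.abs_sum_le_sum_abs _ _).trans (Finset.sum_le_sum fun σ _ => ?_)
  have hprod : ‖m (σ 0)‖ * ‖m (σ 1)‖ * ‖m (σ 2)‖ = ∏ i, ‖m i‖ := by
    rw [← Equiv.prod_comp σ (fun i => ‖m i‖), Fin.prod_univ_three]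
  have h1 := abs_det3_proj_le e β Q hβ hQ (ι 0) (ι 1) (ι 2) (r (σ 0)) (r (σ 1)) (r (σ 2)) (m (σ 0)) (m (σ 1)) (m (σ 2))
  have h2 := abs_det3_proj_le e β Q hβ hQ (ι 0) (ι 1) (ι 3) (r (σ 0)) (r (σ 1)) (r (σ 2)) (m (σ 0)) (m (σ 1)) (m (σ 2))
  have h3 := abs_det3_proj_le e β Q hβ hQ (ι 0) (ι 2) (ι 3) (r (σ 0)) (r (σ 1)) (r (σ 2)) (m (σ 0)) (m (σ 1)) (m (σ 2))
  have h4 := abs_det3_proj_le e β Q hβ hQ (ι 1) (ι 2) (ι 3) (r (σ 0)) (r (σ 1)) (r (σ 2)) (m (σ 0)) (m (σ 1)) (m (σ 2))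
  rw [hf, abs_mul, ← hprod, mul_assoc]
  refine mul_le_mul_of_nonneg_left ?_ (abs_nonneg g)
  push_cast
  refine (abs_sub _ _).trans ((add_le_add ((abs_sub _ _).trans (add_le_add ((abs_add_le _ _).trans (add_le_add h1 h2)) h3)) h4).trans
    (le_of_eq ?_))
  push_cast
  ring

/-- A block triple matched (in some order) against a signed term FACTORS THROUGH the plaquette's bonds: `r = ι ∘ (t ∘ σ⁻¹)`. [folklore] -/
theorem eq_comp_of_match (r : Fin 3 → B) (σ : Equiv.Perm (Fin 3)) (a b c : Fin 4)
    (h : r (σ 0) = ι a ∧ r (σ 1) = ι b ∧ r (σ 2) = ι c) : r = ι ∘ (![a, b, c] ∘ σ.symm) := by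
  funext i
  obtain ⟨k, rfl⟩ := σ.surjective i
  simp only [Function.comp_apply, Equiv.symm_apply_apply]
  fin_cases k <;> simp [h.1, h.2.1, h.2.2]

/-- **LOCALITY OF THE MATCH COUNT**: a block triple that is not of the form `ι ∘ r'` matches nothing — `N_ι(r) = 0`. [folklore] -/
theorem matchCount_eq_zero_of_forall_ne [DecidableEq B] (r : Fin 3 → B) (h : ∀ r' : Fin 3 → Fin 4, r ≠ ι ∘ r') :
    (∑ σ : Equiv.Perm (Fin 3),
        ((if r (σ 0) = ι 0 ∧ r (σ 1) = ι 1 ∧ r (σ 2) = ι 2 then 1 else 0) + (if r (σ 0) = ι 0 ∧ r (σ 1) = ι 1 ∧ r (σ 2) = ι 3 then 1 else 0)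
          + (if r (σ 0) = ι 0 ∧ r (σ 1) = ι 2 ∧ r (σ 2) = ι 3 then 1 else 0)
          + (if r (σ 0) = ι 1 ∧ r (σ 1) = ι 2 ∧ r (σ 2) = ι 3 then 1 else 0) : ℕ)) = 0 := by
  refine Finset.sum_eq_zero fun σ _ => ?_
  have h1 : ¬ (r (σ 0) = ι 0 ∧ r (σ 1) = ι 1 ∧ r (σ 2) = ι 2) := fun hm => h _ (eq_comp_of_match ι r σ 0 1 2 hm)
  have h2 : ¬ (r (σ 0) = ι 0 ∧ r (σ 1) = ι 1 ∧ r (σ 2) = ι 3) := fun hm => h _ (eq_comp_of_match ι r σ 0 1 3 hm)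
  have h3 : ¬ (r (σ 0) = ι 0 ∧ r (σ 1) = ι 2 ∧ r (σ 2) = ι 3) := fun hm => h _ (eq_comp_of_match ι r σ 0 2 3 hm)
  have h4 : ¬ (r (σ 0) = ι 1 ∧ r (σ 1) = ι 2 ∧ r (σ 2) = ι 3) := fun hm => h _ (eq_comp_of_match ι r σ 1 2 3 hm)
  simp only [h1, h2, h3, h4, if_false, add_zero]

/-- **THE COUNT IN THE LATTICE**: for `ι` injective, every slot `s` and every bond `ι j` of the plaquette, `Σ_{r : r s = ι j} N_ι(r) = 6` — the block
triples through `ι j` that match anything are exactly the `ι ∘ r'` with `r' s = j`, and on those the count is `…PlaquetteCubicBlockTable`'s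
(`= 6`, kernel `decide`). [folklore] -/
theorem sum_matchCount_eq_six [Fintype B] [DecidableEq B] (hι : Function.Injective ι) (s : Fin 3) (j : Fin 4) :
    ∑ r ∈ (univ : Finset (Fin 3 → B)).filter (fun r => r s = ι j), ∑ σ : Equiv.Perm (Fin 3),
        ((if r (σ 0) = ι 0 ∧ r (σ 1) = ι 1 ∧ r (σ 2) = ι 2 then 1 else 0) + (if r (σ 0) = ι 0 ∧ r (σ 1) = ι 1 ∧ r (σ 2) = ι 3 then 1 else 0)
          + (if r (σ 0) = ι 0 ∧ r (σ 1) = ι 2 ∧ r (σ 2) = ι 3 then 1 else 0)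
          + (if r (σ 0) = ι 1 ∧ r (σ 1) = ι 2 ∧ r (σ 2) = ι 3 then 1 else 0) : ℕ)
      = 6 := by
  classical
  set N : (Fin 3 → B) → ℕ := fun r => ∑ σ : Equiv.Perm (Fin 3),
      ((if r (σ 0) = ι 0 ∧ r (σ 1) = ι 1 ∧ r (σ 2) = ι 2 then 1 else 0) + (if r (σ 0) = ι 0 ∧ r (σ 1) = ι 1 ∧ r (σ 2) = ι 3 then 1 else 0)
        + (if r (σ 0) = ι 0 ∧ r (σ 1) = ι 2 ∧ r (σ 2) = ι 3 then 1 else 0)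
        + (if r (σ 0) = ι 1 ∧ r (σ 1) = ι 2 ∧ r (σ 2) = ι 3 then 1 else 0) : ℕ) with hN
  have hinj : Set.InjOn (fun r' : Fin 3 → Fin 4 => ι ∘ r') ↑((univ : Finset (Fin 3 → Fin 4)).filter (fun r' => r' s = j)) :=
    fun r₁ _ r₂ _ h => funext fun i => hι (congrFun h i)
  have hsub : ((univ : Finset (Fin 3 → Fin 4)).filter (fun r' => r' s = j)).image (fun r' => ι ∘ r')
      ⊆ (univ : Finset (Fin 3 → B)).filter (fun r => r s = ι j) := by
    intro r hr
    simp only [Finset.mem_image, Finset.mem_filter, Finset.mem_univ, true_and] at hr ⊢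
    obtain ⟨r', hr', rfl⟩ := hr
    rw [Function.comp_apply, hr']
  have hzero : ∀ r ∈ (univ : Finset (Fin 3 → B)).filter (fun r => r s = ι j),
      r ∉ ((univ : Finset (Fin 3 → Fin 4)).filter (fun r' => r' s = j)).image (fun r' => ι ∘ r') → N r = 0 := by
    intro r hr hnot
    rw [hN]
    refine matchCount_eq_zero_of_forall_ne ι r fun r' h => hnot ?_
    simp only [Finset.mem_image, Finset.mem_filter, Finset.mem_univ, true_and] at hr ⊢
    refine ⟨r', hι ?_, h.symm⟩
    rw [← Function.comp_apply (f := ι) (g := r') (x := s), ← h, hr]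
  rw [← PlaquetteCubicBlockTable.count_matches_eq_six s j, ← Finset.sum_subset hsub hzero, Finset.sum_image hinj]
  refine Finset.sum_congr rfl fun r' _ => ?_
  simp only [hN, Function.comp_apply, hι.eq_iff]

/-- **THE BLOCK TABLE OF A PLAQUETTE TERM IN THE LATTICE**: at each of its bonds `ι j`, in every slot `s`, at every point `z`, `Σ_{r : r s = ι j} ‖D³P(z) ∘ (Q_{r0}, Q_{r1}, Q_{r2})‖_op ≤ 6·|g|`. [folklore] -/
theorem blockFibreSum_thirdDeriv_le [Fintype B] [DecidableEq B] (hβ : ∀ v b i, β v b i = v (e.symm (b, i)))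
    (hQ : ∀ b x j, Q b x j = if (e j).1 = b then x j else 0) (hι : Function.Injective ι)
    (f : ContinuousMultilinearMap ℝ (fun _ : Fin 3 => EuclideanSpace ℝ (Fin n)) ℝ) (g : ℝ)
    (hf : ∀ m, f m = g * (β (m 0) (ι 0) ⬝ᵥ β (m 1) (ι 1) ⨯₃ β (m 2) (ι 2) + β (m 0) (ι 0) ⬝ᵥ β (m 1) (ι 1) ⨯₃ β (m 2) (ι 3)
      - β (m 0) (ι 0) ⬝ᵥ β (m 1) (ι 2) ⨯₃ β (m 2) (ι 3) - β (m 0) (ι 1) ⬝ᵥ β (m 1) (ι 2) ⨯₃ β (m 2) (ι 3)))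
    (z : EuclideanSpace ℝ (Fin n)) (s : Fin 3) (j : Fin 4) :
    ∑ r ∈ univ.filter (fun r : Fin 3 → B => r s = ι j),
      ‖(iteratedFDeriv ℝ 3 (fun x => f (fun _ => x)) z).compContinuousLinearMap (fun i => Q (r i))‖ ≤ 6 * |g| := by
  refine (Finset.sum_le_sum fun r _ => norm_blockEntry_le e β Q ι hβ hQ f g hf z r).trans ?_
  rw [← Finset.mul_sum, ← Nat.cast_sum, sum_matchCount_eq_six ι hι s j, Nat.cast_ofNat, mul_comm]

/-- **LOCALITY**: a block entry of `D³P` with one block off the plaquette VANISHES. [folklore] -/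
theorem blockEntry_eq_zero [DecidableEq B] (hβ : ∀ v b i, β v b i = v (e.symm (b, i)))
    (hQ : ∀ b x j, Q b x j = if (e j).1 = b then x j else 0)
    (f : ContinuousMultilinearMap ℝ (fun _ : Fin 3 => EuclideanSpace ℝ (Fin n)) ℝ) (g : ℝ)
    (hf : ∀ m, f m = g * (β (m 0) (ι 0) ⬝ᵥ β (m 1) (ι 1) ⨯₃ β (m 2) (ι 2) + β (m 0) (ι 0) ⬝ᵥ β (m 1) (ι 1) ⨯₃ β (m 2) (ι 3)
      - β (m 0) (ι 0) ⬝ᵥ β (m 1) (ι 2) ⨯₃ β (m 2) (ι 3) - β (m 0) (ι 1) ⬝ᵥ β (m 1) (ι 2) ⨯₃ β (m 2) (ι 3)))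
    (z : EuclideanSpace ℝ (Fin n)) (r : Fin 3 → B) (s : Fin 3) (hs : ∀ j, r s ≠ ι j) :
    (iteratedFDeriv ℝ 3 (fun x => f (fun _ => x)) z).compContinuousLinearMap (fun i => Q (r i)) = 0 := by
  have h := norm_blockEntry_le e β Q ι hβ hQ f g hf z r
  rw [matchCount_eq_zero_of_forall_ne ι r fun r' hr => hs (r' s) (by rw [hr, Function.comp_apply]), Nat.cast_zero, mul_zero] at h
  exact norm_le_zero_iff.1 h

end Plaquette

/-! ## §3 The flat point: `D²(Σ_p f_p(x,x,x))(0) = 0` -/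

/-- The second derivative AT `0` of a finite sum of diagonals of trilinear forms vanishes: each diagonal is `f ∘ ι`, `ι` the linear diagonal
embedding, and `‖D²f(0)‖ ≤ 3·2·‖f‖·‖0‖ = 0` (Mathlib's `ContinuousMultilinearMap.norm_iteratedFDeriv_le`; cf. `…PlaquetteCubicWindow`). [folklore] -/
theorem iteratedFDeriv_two_sum_diag_zero {𝔓 : Type*} [Fintype 𝔓]
    (f : 𝔓 → ContinuousMultilinearMap ℝ (fun _ : Fin 3 => EuclideanSpace ℝ (Fin n)) ℝ) :
    iteratedFDeriv ℝ 2 (fun x : EuclideanSpace ℝ (Fin n) => ∑ p, f p (fun _ => x)) 0 = 0 := by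
  let ι : EuclideanSpace ℝ (Fin n) →L[ℝ] (Fin 3 → EuclideanSpace ℝ (Fin n)) := ContinuousLinearMap.pi fun _ => ContinuousLinearMap.id ℝ _
  have hC : ∀ p, ContDiff ℝ 3 (fun x : EuclideanSpace ℝ (Fin n) => f p (fun _ => x)) := fun p =>
    (f p).contDiff.comp (contDiff_pi.2 fun _ => contDiff_id)
  have h1 : ∀ p, iteratedFDeriv ℝ 2 (fun x : EuclideanSpace ℝ (Fin n) => f p (fun _ => x)) 0 = 0 := fun p => by
    have hcomp : (fun x : EuclideanSpace ℝ (Fin n) => f p (fun _ => x)) = ⇑(f p) ∘ ⇑ι := rfl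
    rw [hcomp, ContinuousLinearMap.iteratedFDeriv_comp_right ι (f p).contDiff 0 le_rfl, map_zero]
    have h0 : iteratedFDeriv ℝ 2 (⇑(f p)) 0 = 0 := by
      have h := (f p).norm_iteratedFDeriv_le 2 (0 : Fin 3 → EuclideanSpace ℝ (Fin n))
      norm_num [Fintype.card_fin, norm_zero] at h; simpa using h
    rw [h0]; rfl
  rw [iteratedFDeriv_fun_sum_apply fun p _ => ((hC p).of_le (by norm_num)).contDiffAt]
  exact Finset.sum_eq_zero fun p _ => h1 p

/-! ## §4 The hypotheses INHABITED for a bond set: the block projections and the slot form of a plaquette term -/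

section Inhabited

variable (e : Fin n ≃ B × Fin 3)

/-- **THE BLOCK PROJECTIONS EXIST** (`Q_b := Σ_{j in block b} proj_j ⊗ e_j`). [folklore] -/
theorem exists_proj [DecidableEq B] :
    ∃ Q : B → EuclideanSpace ℝ (Fin n) →L[ℝ] EuclideanSpace ℝ (Fin n), ∀ b x j, Q b x j = if (e j).1 = b then x j else 0 := by
  classical
  refine ⟨fun b => ∑ j ∈ univ.filter (fun j => (e j).1 = b),
    (EuclideanSpace.proj j).smulRight (EuclideanSpace.single j (1 : ℝ)), fun b x j => ?_⟩
  simp only [_root_.sum_apply, ContinuousLinearMap.smulRight_apply, PiLp.proj_apply, WithLp.ofLp_sum, WithLp.ofLp_smul,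
    PiLp.ofLp_single, Finset.sum_apply, Pi.smul_apply, smul_eq_mul, Pi.single_apply, mul_ite, mul_one, mul_zero,
    Finset.sum_ite_eq, Finset.mem_filter, Finset.mem_univ, true_and]

/-- **THE SLOT FORM OF A PLAQUETTE TERM IS A CONTINUOUS TRILINEAR FORM** (any four bonds `ι`, any `g`: `24` signed coordinate monomials). [folklore] -/
theorem exists_slotForm (β : EuclideanSpace ℝ (Fin n) → B → Fin 3 → ℝ) (hβ : ∀ v b i, β v b i = v (e.symm (b, i)))
    (ι : Fin 4 → B) (g : ℝ) :
    ∃ f : ContinuousMultilinearMap ℝ (fun _ : Fin 3 => EuclideanSpace ℝ (Fin n)) ℝ,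
      ∀ m, f m = g * (β (m 0) (ι 0) ⬝ᵥ β (m 1) (ι 1) ⨯₃ β (m 2) (ι 2) + β (m 0) (ι 0) ⬝ᵥ β (m 1) (ι 1) ⨯₃ β (m 2) (ι 3)
        - β (m 0) (ι 0) ⬝ᵥ β (m 1) (ι 2) ⨯₃ β (m 2) (ι 3) - β (m 0) (ι 1) ⬝ᵥ β (m 1) (ι 2) ⨯₃ β (m 2) (ι 3)) := by
  let M : (Fin 3 → Fin 4) → (Fin 3 → Fin 3) → ContinuousMultilinearMap ℝ (fun _ : Fin 3 => EuclideanSpace ℝ (Fin n)) ℝ :=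
    fun t c => (ContinuousMultilinearMap.mkPiAlgebra ℝ (Fin 3) ℝ).compContinuousLinearMap
      fun s => EuclideanSpace.proj (e.symm (ι (t s), c s))
  let D : Fin 4 → Fin 4 → Fin 4 → ContinuousMultilinearMap ℝ (fun _ : Fin 3 => EuclideanSpace ℝ (Fin n)) ℝ :=
    fun a b c => M ![a, b, c] ![0, 1, 2] - M ![a, b, c] ![0, 2, 1] - M ![a, b, c] ![1, 0, 2]
      + M ![a, b, c] ![1, 2, 0] + M ![a, b, c] ![2, 0, 1] - M ![a, b, c] ![2, 1, 0]
  refine ⟨g • (D 0 1 2 + D 0 1 3 - D 0 2 3 - D 1 2 3), fun m => ?_⟩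
  simp only [D, M, smul_apply, add_apply, sub_apply, ContinuousMultilinearMap.compContinuousLinearMap_apply, ContinuousMultilinearMap.mkPiAlgebra_apply, Fin.prod_univ_three,
    Matrix.cons_val_zero, Matrix.cons_val_one, Matrix.cons_val_two, Matrix.head_cons, Matrix.tail_cons, EuclideanSpace.coe_proj,
    smul_eq_mul, cross_apply, dotProduct, Fin.sum_univ_three, hβ]
  ring

end Inhabited

/-! ## §5 The ENDs on T-61's per-bond window for the lattice sum, BY NAME (`…ConvexWindowSuppliersCells`) and BY VALUE (`c = 6γ`, `‖D²P(0)‖ = 0`) -/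

section End

variable {𝔓 : Type*} [Fintype 𝔓] (e : Fin n ≃ B × Fin 3) (β : EuclideanSpace ℝ (Fin n) → B → Fin 3 → ℝ)
  (Q : B → EuclideanSpace ℝ (Fin n) →L[ℝ] EuclideanSpace ℝ (Fin n)) (ι : 𝔓 → Fin 4 → B)

/-- **THE END FOR `⟪x, A x⟫ + Σ_p f_p(x,x,x)`, `f_p` THE SLOT FORM OF `g_p·P₃(x ∘ ι_p)`** — `…ConvexWindowSuppliersCells`'s END with `S_p = range ι_p`,
the per-cell tables `c = 6γ` (§2) in both read slots, the locality (§2), `Σ_b Q_b = id` ∕ Pythagoras ∕ idempotence (§1), `P_p ∈ C³` and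
`‖D²P(0)‖ = 0` (§3) ALL DISCHARGED.  Displayed: `σ` (`A` symmetric `σ`-coercive), `γ ≥ |g_p|`, the per-bond radius `a ≥ 0` of the window
`K = L ∩ ⋂_b {‖Q_b y‖ ≤ a}` (`L` a linear subspace), and the overlap `ν` (every bond in at most `ν` plaquettes).  Modulus `2σ − 6·ν·γ·a`. [folklore] -/
theorem firstOrderOn_quadratic_add_latticeSlotForms_blockWindow [Fintype B] [DecidableEq B] [Nonempty B] (hβ : ∀ v b i, β v b i = v (e.symm (b, i)))
    (hQ : ∀ b x j, Q b x j = if (e j).1 = b then x j else 0) (hι : ∀ p, Function.Injective (ι p))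
    (f : 𝔓 → ContinuousMultilinearMap ℝ (fun _ : Fin 3 => EuclideanSpace ℝ (Fin n)) ℝ) (g : 𝔓 → ℝ) {γ : ℝ} (hγ₀ : 0 ≤ γ) (hγ : ∀ p, |g p| ≤ γ)
    (hf : ∀ p m, f p m = g p * (β (m 0) (ι p 0) ⬝ᵥ β (m 1) (ι p 1) ⨯₃ β (m 2) (ι p 2) + β (m 0) (ι p 0) ⬝ᵥ β (m 1) (ι p 1) ⨯₃ β (m 2) (ι p 3)
      - β (m 0) (ι p 0) ⬝ᵥ β (m 1) (ι p 2) ⨯₃ β (m 2) (ι p 3) - β (m 0) (ι p 1) ⬝ᵥ β (m 1) (ι p 2) ⨯₃ β (m 2) (ι p 3)))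
    {ν : ℕ} (hν : ∀ b : B, (Finset.univ.filter fun p => b ∈ Finset.univ.image (ι p)).card ≤ ν)
    (A : EuclideanSpace ℝ (Fin n) →L[ℝ] EuclideanSpace ℝ (Fin n)) (L : Submodule ℝ (EuclideanSpace ℝ (Fin n))) {a σ : ℝ} (ha : 0 ≤ a)
    (hA : ∀ v w : EuclideanSpace ℝ (Fin n), ⟪A v, w⟫ = ⟪v, A w⟫) (hσ : ∀ v : EuclideanSpace ℝ (Fin n), σ * ‖v‖ ^ 2 ≤ ⟪v, A v⟫) :
    ∀ x ∈ (L : Set (EuclideanSpace ℝ (Fin n))) ∩ {y | ∀ b, ‖Q b y‖ ≤ a},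
      ∀ y ∈ (L : Set (EuclideanSpace ℝ (Fin n))) ∩ {y | ∀ b, ‖Q b y‖ ≤ a},
        (⟪x, A x⟫ + ∑ p, f p (fun _ => x)) + ⟪gradient (fun z : EuclideanSpace ℝ (Fin n) => ⟪z, A z⟫ + ∑ p, f p (fun _ => z)) x, y - x⟫ +
          (2 * σ - 6 * ν * γ * a) / 2 * ‖y - x‖ ^ 2 ≤ ⟪y, A y⟫ + ∑ p, f p (fun _ => y) := by
  have h := ConvexWindowSuppliersCells.firstOrderOn_quadratic_add_sum_of_cellTables_blockWindow A Q (proj_sum e Q hQ)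
    (proj_pythagoras e Q hQ) (proj_idem e Q hQ) L ha (mul_nonneg (by norm_num) hγ₀ : (0 : ℝ) ≤ 6 * γ) hA hσ (fun p x => f p (fun _ => x))
    (fun p => (f p).contDiff.comp (contDiff_pi.2 fun _ => contDiff_id)) (fun p => Finset.univ.image (ι p)) hν
    (fun z _ p r s _ hs => blockEntry_eq_zero e β Q (ι p) hβ hQ (f p) (g p) (hf p) z r s fun j hj =>
      hs (Finset.mem_image.2 ⟨j, Finset.mem_univ _, hj.symm⟩))
    (fun z _ p s _ b hb => by
      obtain ⟨j, -, rfl⟩ := Finset.mem_image.1 hb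
      exact (blockFibreSum_thirdDeriv_le e β Q (ι p) hβ hQ (hι p) (f p) (g p) (hf p) z s j).trans (by linarith [hγ p]))
  have hcoef : 2 * σ - (‖iteratedFDeriv ℝ 2 (fun z : EuclideanSpace ℝ (Fin n) => ∑ p, f p (fun _ => z)) 0‖ + ↑ν * (6 * γ) * a)
      = 2 * σ - 6 * ν * γ * a := by
    rw [iteratedFDeriv_two_sum_diag_zero, norm_zero]; ring
  simpa only [hcoef] using h

/-- **THE END, `f`-FREE AND READER-FREE: THE CONVEXITY LETTER FOR `⟪x, A x⟫ + Σ_p g_p·P₃(x ∘ ι_p)` ON THE PER-BOND WINDOW, MODULUS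
`2σ − 6·ν·γ·a`** — `P₃` written out in the chart `e` (`x_b = (i ↦ x (e.symm (b, i)))`, `det` the triple product); `ι_p` the four distinct bonds of
`p`; `Q` the bond-block projections (`hQ`; they exist, §4); `K = L ∩ ⋂_b {‖Q_b y‖ ≤ a}`; `A` symmetric `σ`-coercive. Displayed: `σ, γ, a, ν` ONLY. [folklore] -/
theorem firstOrderOn_quadratic_add_latticeCubic [Fintype B] [DecidableEq B] [Nonempty B] (hQ : ∀ b x j, Q b x j = if (e j).1 = b then x j else 0)
    (hι : ∀ p, Function.Injective (ι p)) (g : 𝔓 → ℝ) {γ : ℝ} (hγ₀ : 0 ≤ γ) (hγ : ∀ p, |g p| ≤ γ)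
    {ν : ℕ} (hν : ∀ b : B, (Finset.univ.filter fun p => b ∈ Finset.univ.image (ι p)).card ≤ ν)
    (A : EuclideanSpace ℝ (Fin n) →L[ℝ] EuclideanSpace ℝ (Fin n)) (L : Submodule ℝ (EuclideanSpace ℝ (Fin n))) {a σ : ℝ} (ha : 0 ≤ a)
    (hA : ∀ v w : EuclideanSpace ℝ (Fin n), ⟪A v, w⟫ = ⟪v, A w⟫) (hσ : ∀ v : EuclideanSpace ℝ (Fin n), σ * ‖v‖ ^ 2 ≤ ⟪v, A v⟫) :
    ∀ x ∈ (L : Set (EuclideanSpace ℝ (Fin n))) ∩ {y | ∀ b, ‖Q b y‖ ≤ a},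
      ∀ y ∈ (L : Set (EuclideanSpace ℝ (Fin n))) ∩ {y | ∀ b, ‖Q b y‖ ≤ a},
        (⟪x, A x⟫ + ∑ p, g p * ((fun i : Fin 3 => x (e.symm (ι p 0, i))) ⬝ᵥ (fun i => x (e.symm (ι p 1, i))) ⨯₃ (fun i => x (e.symm (ι p 2, i)))
            + (fun i : Fin 3 => x (e.symm (ι p 0, i))) ⬝ᵥ (fun i => x (e.symm (ι p 1, i))) ⨯₃ (fun i => x (e.symm (ι p 3, i)))
            - (fun i : Fin 3 => x (e.symm (ι p 0, i))) ⬝ᵥ (fun i => x (e.symm (ι p 2, i))) ⨯₃ (fun i => x (e.symm (ι p 3, i)))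
            - (fun i : Fin 3 => x (e.symm (ι p 1, i))) ⬝ᵥ (fun i => x (e.symm (ι p 2, i))) ⨯₃ (fun i => x (e.symm (ι p 3, i)))))
        + ⟪gradient (fun z : EuclideanSpace ℝ (Fin n) => ⟪z, A z⟫
            + ∑ p, g p * ((fun i : Fin 3 => z (e.symm (ι p 0, i))) ⬝ᵥ (fun i => z (e.symm (ι p 1, i))) ⨯₃ (fun i => z (e.symm (ι p 2, i)))
              + (fun i : Fin 3 => z (e.symm (ι p 0, i))) ⬝ᵥ (fun i => z (e.symm (ι p 1, i))) ⨯₃ (fun i => z (e.symm (ι p 3, i)))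
              - (fun i : Fin 3 => z (e.symm (ι p 0, i))) ⬝ᵥ (fun i => z (e.symm (ι p 2, i))) ⨯₃ (fun i => z (e.symm (ι p 3, i)))
              - (fun i : Fin 3 => z (e.symm (ι p 1, i))) ⬝ᵥ (fun i => z (e.symm (ι p 2, i))) ⨯₃ (fun i => z (e.symm (ι p 3, i))))) x,
            y - x⟫
        + (2 * σ - 6 * ν * γ * a) / 2 * ‖y - x‖ ^ 2
        ≤ ⟪y, A y⟫ + ∑ p, g p * ((fun i : Fin 3 => y (e.symm (ι p 0, i))) ⬝ᵥ (fun i => y (e.symm (ι p 1, i))) ⨯₃ (fun i => y (e.symm (ι p 2, i)))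
            + (fun i : Fin 3 => y (e.symm (ι p 0, i))) ⬝ᵥ (fun i => y (e.symm (ι p 1, i))) ⨯₃ (fun i => y (e.symm (ι p 3, i)))
            - (fun i : Fin 3 => y (e.symm (ι p 0, i))) ⬝ᵥ (fun i => y (e.symm (ι p 2, i))) ⨯₃ (fun i => y (e.symm (ι p 3, i)))
            - (fun i : Fin 3 => y (e.symm (ι p 1, i))) ⬝ᵥ (fun i => y (e.symm (ι p 2, i))) ⨯₃ (fun i => y (e.symm (ι p 3, i)))) := by
  choose f hf using fun p => exists_slotForm e (fun v b i => v (e.symm (b, i))) (fun _ _ _ => rfl) (ι p) (g p)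
  intro x hx y hy
  have h := firstOrderOn_quadratic_add_latticeSlotForms_blockWindow e (fun v b i => v (e.symm (b, i))) Q ι (fun _ _ _ => rfl) hQ hι
    f g hγ₀ hγ hf hν A L ha hA hσ x hx y hy
  simpa only [hf] using h

end End

end Summit.QuantumFields.BalabanUV.T4Continuum.NE7b.PlaquetteCubicLattice

end
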